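import Literature.MathematicalPhysics.QuantumFieldTheory.Balaban1983to89.B9Thm34HolderInputG
import Literature.MathematicalPhysics.QuantumFieldTheory.Balaban1983to89.B9Thm34HolderGClauseUniformR1

/-!
# `Balaban1983to89.B9Thm34HolderInputGClauseUniformR1` — [Balaban1985BackgroundPropagators] THEOREM 3.4 × THEOREM 3.3, THE INPUT-HÖLDER MEMBERS
# (3.44) ∕ (3.45) OF `G(U′U)`, CONSTANTS BEFORE THE LATTICE, ON r06's KERNEL-FREE G-CLAUSE — r06 FILE 57-G
# `B9Thm34HolderInputGUniform.thm34_all_holderInput_uniform` RE-RUN ON `B9Thm34GUniformR1.thm34_G_clause_uniform` (identities, left-entry clause),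
# `B9Thm34HolderGClauseUniformR1.thm34_G_holder_clause_uniform` (the (3.43)-left member per probe) AND `B9Thm34POneUniformR1` ((3.77)): NO KERNEL-FORM
# LETTER OF G(U), R1 binders (pub-ymgap N06 row 13, steps 13-E4(G) ∕ 13-H2(G))

statement-level skeleton of published theorems with citation tags; proofs where landed; nothing here is a claim about the Yang–Mills mass gap

CITATION HEADER (lean-in-tree rule).  B9 = T. Bałaban, *Propagators for lattice gauge theories in a background field*, Commun. Math. Phys.
**99** (1985) 389–434 [Balaban1985BackgroundPropagators] (held `paper:balaban1985-cmp99-background-propagators`; journal page = PDF page + 388):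
Theorem 3.4 p. 400 [PDF 12] «The extended operators satisfy all the inequalities of Theorems 3.1–3.3 correspondingly»; Theorem 3.3 p. 399 [PDF 11];
(3.44)–(3.45) p. 398 [PDF 10] «|(∇_UG′(U)∇*_Uλ)(x)| ≦ B′₀(ε)(‖λ‖_ε^{ξ′}(L^{j′}η)^ε + |λ|)e^{−δ₀d(y,y′)} for 0 < ε ≦ 1, x ∈ Δ(y), supp λ ⊂ Δ̃(y′)» and
its Hölder-output twin; (3.40) p. 397; p. 399 L1–3 «the constants … do not depend on the sequence {Ω_j}»; p. 403 [PDF 15] l. 1–9 «… of course with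
different constants»; (3.73) p. 405; (3.76)–(3.77) pp. 405–406; (3.82)–(3.86) p. 407 [PDF 19].  [4] = [Balaban1984PropagatorsII] (2.51)–(2.55) p. 232;
Lemma 2.1 p. 234 with (2.59) p. 233.  [Balaban1985Variational] (135) p. 298 (the (3.35) reading).  Rows B9.Thm3.4 × B9.Thm3.3 ((3.44)/(3.45)
cells) × B9.Eq3.73–3.86 × B6.Lemma2.1 (cells only; no row head changes).

WHY THIS FILE (pub-ymgap N06 row 13, seat dag-n06-c gen 6; `GSIDE-L2-SPEC.md` §G; sibling of `B9Thm34HolderGClauseUniformR1`, whose header states the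
case).  r06 FILE 57-G obtains `C⁻¹(U′U), G(U′U)` and the left-entry clause from `B9Thm34AllUniform.thm34_all_uniform` (KERNEL-FORM letters of G(U),
vacuous on multi-point blocks — lit-balaban desk ME #13) and the (3.43)-left member from FILE 55 (same kernel letters).  Both are IDLE: the kernel-free
clause `B9Thm34GUniformR1.thm34_G_clause_uniform` supplies the pair, the identities and the clause; this lineage's `thm34_G_holder_clause_uniform`
supplies the (3.43)-left member; `B9Thm34POneUniformR1` supplies (3.77) in the R1 binder shape; FILE 38's devices `input344_of_inverse` ∕
`input345_of_inverse`, (3.83) `ineq383_op`, (3.84) `eq384_sub`, (3.76) `eq376_concrete`, the gen-11 identifications of the concrete `V₃(A)` are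
kernel-free already.  THIS FILE is FILE 57-G's re-run with those three callee swaps and NOTHING ELSE changed in the body.

WHAT IS PROVED (1 theorem: 0 `def`, 0 sorry, 0 new named facts; standard axioms):
* ★★ **`thm34_G_holderInput_clause_uniform`** — hypotheses = `thm34_G_clause_uniform`'s VERBATIM plus the lattice-free `0 < B₀` (NO kernel-form letter,
  no `Δ′_a(U)` letter); conclusion = FILE 57-G's verbatim in shape: `∃ a₁ > 0 ∃ B ≧ 0 ∀ (lattice, …) ∀ α₁ ≦ a₁ ∀ A … ∃ C⁻¹(U′U), G(U′U)` (identities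
  re-exported) with (v) the (3.44)-type member and (vi) the (3.45)-type member of THIS `G(U′U)` at `(B, δ₀/7)`, per pair of letters `D_l`, `D_s`, per
  block-supported input and per probe.

PROOF.  FILE 57-G's proof (scripted from the tree text) with `thm34_all_uniform` ⟶ `thm34_G_clause_uniform` (R1), `thm34_all_holder_uniform` ⟶
`thm34_G_holder_clause_uniform`, `B9Thm34GKernelUniform.exists_threshold_pOne_uniform` ⟶ `B9Thm34POneUniformR1.exists_threshold_pOne_uniform`; the
destructuring patterns adjusted; the kernel and `Δ′_a(U)` binders deleted; everything else verbatim.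

HONEST SCOPE / NOT CLAIMED.  As FILE 57-G ∕ FILE 37 (module headers there): Theorems 3.1/3.3 FOR `U` enter per input ∕ per functional ((3.44)/(3.45)
for `U` as the data `N`, `N₂`); `Φ` arbitrary; rates `δ₀ → δ₀/7` one admissible choice («with different constants», p. 403); 9/5000 and the cascade
exponents are proof constants of the r06 chain, not printed numbers.  Nothing of [B9] is asserted; no row head changes; NOT a node discharge; nothing
continuum / OS / mass-gap / Clay.  Cell `pub-ymgap` (HUMAN RULING D-0062), Track A node N06 [B9], N06-ASSIGNMENT row 13, seat `pub-ymgap-dag-n06-c`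
(g6), 2026-08-27.  Count-neutral.

RELATED IN THE TREE, NOT DUPLICATED (searched 2026-08-27: `lean search 'holderInput_clause' --decl` = ∅): FILE 57-G `B9Thm34HolderInputGUniform`
(kernel-form statement; kept — it has importers), FILE 37∕38 `B9Thm34HolderInputG` (devices USED BY NAME), `B9Thm34GUniformR1`,
`B9Thm34HolderGClauseUniformR1`, `B9Thm34POneUniformR1` — all USED BY NAME; no existing module modified.
-/

noncomputable section

namespace Literature.MathematicalPhysics.QuantumFieldTheory.Balaban1983to89.B9Thm34HolderInputGClauseUniformR1

open NormedSpace Complex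
open Literature.MathematicalPhysics.QuantumFieldTheory.Balaban1983to89
open Literature.MathematicalPhysics.QuantumFieldTheory.Balaban1983to89.B6RandomWalk (HasMajorant BlockSupp hasMajorant_mono Triangle254 Ineq261
  blockPiece sum_blockPiece blockSupp_blockPiece hasMajorant_add)
open Literature.MathematicalPhysics.QuantumFieldTheory.Balaban1983to89.B6RandomWalkHom (HasMajorantHom)
open Literature.MathematicalPhysics.QuantumFieldTheory.Balaban1983to89.B6RandomWalkSection (secExt secRes secConj)
open Literature.MathematicalPhysics.QuantumFieldTheory.Balaban1983to89.B9Thm34Ext (toB6)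
open Literature.MathematicalPhysics.QuantumFieldTheory.Balaban1983to89.B9Ineq347 (ScaleTransfer)
open Literature.MathematicalPhysics.QuantumFieldTheory.Balaban1983to89.B9Eq386Neumann (vTotal vThree pTwo deltaA eq384_sub)
open Literature.MathematicalPhysics.QuantumFieldTheory.Balaban1983to89.B9Eq39Adjoint
open Literature.MathematicalPhysics.QuantumFieldTheory.Balaban1983to89.B9Eq369Small (Through)
open Literature.MathematicalPhysics.QuantumFieldTheory.Balaban1983to89.B9Eq372Locality (stBonds)
open Literature.MathematicalPhysics.QuantumFieldTheory.Balaban1983to89.B9Eq352DivForm (tauF tauB)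
open Literature.MathematicalPhysics.QuantumFieldTheory.Balaban1983to89.B9Eq352DivFormLetters
open Literature.MathematicalPhysics.QuantumFieldTheory.Balaban1983to89.B9Eq352GradLetters (diffLetter)
open Literature.MathematicalPhysics.QuantumFieldTheory.Balaban1983to89.B9Eq371GradLetters (bT bU zeroLetter V1Letter)
open Literature.MathematicalPhysics.QuantumFieldTheory.Balaban1983to89.B9Eq375GradLetters (zeroLetter₂ V1Letter₂)
open Literature.MathematicalPhysics.QuantumFieldTheory.Balaban1983to89.B9Eq372RemLetters
open Literature.MathematicalPhysics.QuantumFieldTheory.Balaban1983to89.B9Eq382V3Letters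
open Literature.MathematicalPhysics.QuantumFieldTheory.Balaban1983to89.B9Eq376POneLetters (conjHom gradLin divLin eq376_concrete)
open Literature.MathematicalPhysics.QuantumFieldTheory.Balaban1983to89.B9Eq360Vprime (gPrimeExtEnd)
open Literature.MathematicalPhysics.QuantumFieldTheory.Balaban1983to89.B9Eq360VprimeLetters (vPrimeConc)
open Literature.MathematicalPhysics.QuantumFieldTheory.Balaban1983to89.B9Ineq385VG (kappa383 kappa383_nonneg ineq383_op)
open Literature.MathematicalPhysics.QuantumFieldTheory.Balaban1983to89.B9Ineq385V3Concrete (cV385 cV0_nonneg cV385_nonneg)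
open Literature.MathematicalPhysics.QuantumFieldTheory.Balaban1983to89.B9Ineq385Kernel (exp_rate_mono)
open Literature.MathematicalPhysics.QuantumFieldTheory.Balaban1983to89.B9Ineq366CPrime (conv_le scaleTransfer_one hasMajorant_rate_mono)
open Literature.MathematicalPhysics.QuantumFieldTheory.Balaban1983to89.B9Thm34GKernelFinal (exists_bound_of_continuousAt)
open Literature.MathematicalPhysics.QuantumFieldTheory.Balaban1983to89.B9Thm34GUniformR1 (thm34_G_clause_uniform)
open Literature.MathematicalPhysics.QuantumFieldTheory.Balaban1983to89.B9Thm34HolderGClauseUniformR1 (thm34_G_holder_clause_uniform)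
open Literature.MathematicalPhysics.QuantumFieldTheory.Balaban1983to89.B9Thm34POneUniformR1 (exists_threshold_pOne_uniform)
open Literature.MathematicalPhysics.QuantumFieldTheory.Balaban1983to89.B9Thm34HolderInputG (abs_apply_le_sum_of_profile norm_apply_le_sum_of_profile
  abs_apply_le_of_profile_decay norm_apply_le_of_profile_decay resolvent_right vTotal_apply_profile resolvent_right_Ds input344_of_inverse
  input345_of_inverse)

section HolderInputU1

variable {𝔸 : Type*} [NormedRing 𝔸] [NormedAlgebra ℂ 𝔸] [CompleteSpace 𝔸] {ι : Type} [Fintype ι]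
variable (b : Module.Basis ι ℝ 𝔸) (κ : Type) [Fintype κ] [LinearOrder κ]

set_option maxHeartbeats 1600000 in
/-- **THEOREM 3.4 × THEOREM 3.3: THE MEMBERS (3.44) AND (3.45) (MIXED SECOND DIFFERENCES, INPUT HÖLDER NORM) FOR THE KERNEL-FREE CLAUSE's `G(U′U)`, THE CONSTANTS
CHOSEN BEFORE THE LATTICE — NO KERNEL-FORM LETTER OF G(U)** («|(∇_UG′(U)∇*_Uλ)(x)| ≦ B′₀(ε)(…)e^{−δ₀d(y,y′)}» (3.44) and its Hölder-output twin (3.45), p. 398; Theorem 3.3 p. 399;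
for `U′U` by Theorem 3.4 p. 400; «the constants … do not depend on the sequence {Ω_j}», p. 399): `∃ a₁ > 0 ∃ B ≧ 0 ∀ (lattice 𝔅 = g, background U,
data, Theorems 3.1–3.3 for U as BLOCK MAJORANTS only; 0 < B₀ hoisted before) ∀ α₁ ≦ a₁ ∀ A ∈ (3.37) ∀ (3.57)/(3.59) letters ∀ (3.80)–(3.82) letters
∃ C⁻¹(U′U), G(U′U)` (r06's kernel-free pair of `B9Thm34GUniformR1.thm34_G_clause_uniform`, identities re-exported) such that for every left letter `D_l` (`D_lG(U) ≺ B₀Lʲηe^{−δ₀d}`), right letter `D_s`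
(`G(U)D_s ≺ B₀Lʲηe^{−δ₀d}`), block-supported `λ` (`|λ| ≦ M`) and `N ≧ 0` with `|(∇_kG(U)D_sλ)(z)| ≦ Ne^{−δ₀d(y_z,y′)}` (`k ∈ κ ⊕ κ`): (v)
`|(D_lG(U)D_sλ)(z)| ≦ Ne^{−δ₀d}` ⟹ `|(D_lG(U′U)D_sλ)(x)| ≦ B(N + M)e^{−(δ₀/7)d(y_x,y′)}`; (vi) for every `ℝ`-linear `𝔸`-valued `Φ` anchored at `y ∋
p₀`, `γ`, `B_h, c_ζ ≧ 0` with the (3.43)-left datum for `U` and every `N₂ ≧ 0` with `‖Φ(D_lG(U)D_sλ)‖ ≦ N₂e^{−δ₀d(y,y′)}`: `‖Φ(D_lG(U′U)D_sλ)‖ ≦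
B(N₂ + B_h(Lʲη)^{1−γ}c_ζ(Lʲη)⁻¹(N + M))e^{−(δ₀/7)d(y,y′)}` — r06 FILE 57-G `thm34_all_holderInput_uniform` verbatim in shape, re-run on the kernel-free clause (R1 binders).
[cite: Balaban1985BackgroundPropagators, Thm 3.4 p.400 + p.399 + Thm 3.1 (3.42)–(3.45) pp.397–398 + Thm 3.3 p.399 + (3.73) p.405 + (3.76)–(3.77) pp.405–406 + (3.82)–(3.86) p.407 + (3.37)/(3.35) p.396; Balaban1984PropagatorsII, (2.51)–(2.55) p.232 + Lemma 2.1 p.234; Balaban1985Variational, (135) p.298] -/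
theorem thm34_G_holderInput_clause_uniform [DecidableEq ι] (d : ℕ)
    (δ₀ B₀ κQ BG B₁ cF Cq a₀ C₀ d₀ M₂ κQb cFb abar : ℝ) (Λf : ℝ → ℝ)
    (hB₀ : 0 ≤ B₀) (hκQ : 0 < κQ) (hBG : 0 < BG) (hB₁ : 0 < B₁) (hcF : 0 < cF) (hCq : 0 ≤ Cq) (ha₀ : 0 ≤ a₀) (hC₀ : 0 ≤ C₀)
    (hM₂ : 0 ≤ M₂) (hδ₀ : 0 < δ₀) (hκQb : 0 ≤ κQb) (hcFb : 0 ≤ cFb) (habar : 0 ≤ abar) (hΛf : ∀ α : ℝ, 0 < α → 1 ≤ Λf α) (hB₀' : 0 < B₀)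
    (hrepr : ∀ (v : 𝔸) (i : ι), |b.repr v i| ≤ M₂ * ‖v‖) :
    ∃ a₁ : ℝ, 0 < a₁ ∧ ∃ B : ℝ, 0 ≤ B ∧
    ∀ {S : Type} [Fintype S] [DecidableEq S] (T : κ → Equiv.Perm S) (U : κ → S → 𝔸ˣ)
      {g : B9.Geometry} [Fintype g.Site] [DecidableEq g.Site] [Nonempty g.Site] {Rr : ℝ} {H : Prop} (blk : S → g.Site)
      (kQ : g.Site → S → 𝔸 →L[ℝ] 𝔸) (sQ : S → 𝔸 →L[ℝ] 𝔸) (cfun w : g.Site → ℝ)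
    -- the multiscale geometry 𝔅 (p. 393, [4] (2.1)–(2.4)) and its axioms
    (hdnn : ∀ a a' : g.Site, 0 ≤ g.dist a a') (htri : Triangle254 (toB6 g Rr H)) (hrefl : ∀ y : g.Site, g.dist y y = 0)
    (hsym : ∀ y y' : g.Site, g.dist y y' = g.dist y' y) (hlen : ∀ y : g.Site, 0 < g.len y) (hlenη : ∀ y : g.Site, g.eta ≤ g.len y)
    (hη : 0 < g.eta) (hL : 1 ≤ g.L)
    -- [4] Lemma 2.1 (2.61) at the rate `δ₀`, for every exponent `9/5000 ≤ α < 1` (R1: the exponents the proof uses; print: «0 < α < 1» with (2.59))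
    (h261 : ∀ α : ℝ, 9 / 5000 ≤ α → α < 1 → Ineq261 d (toB6 g Rr H) δ₀ α)
    -- p. 398: «Using Lemma 2.1 in [4] we may replace the factor (Lʲη)^α by (Lʲη)^β(L^{j′}η)^γ with β + γ = α» — for every exponent
    -- `9/5000 ≤ α` (R1), one constant `Λ(α) ≧ 1` for the six weights `(Lʲη)^{1,2,−1,−2,−4}` (natural and real powers)
      (hST : ∀ α : ℝ, 9 / 5000 ≤ α → ScaleTransfer g δ₀ α (Λf α) (fun a => g.len a) ∧ ScaleTransfer g δ₀ α (Λf α) (fun a => g.len a ^ 2) ∧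
        ScaleTransfer g δ₀ α (Λf α) (fun a => (g.len a)⁻¹) ∧ ScaleTransfer g δ₀ α (Λf α) (fun a => (g.len a ^ 2)⁻¹) ∧
        ScaleTransfer g δ₀ α (Λf α) (fun a => (g.len a ^ 4)⁻¹) ∧ ScaleTransfer g δ₀ α (Λf α) (fun y => g.len y ^ (-(4 : ℝ))))
    -- real coordinates of `𝔸`, commuting translations, unitary-type background
    (hT : ∀ (μ ν : κ) (x : S), T μ (T ν x) = T ν (T μ x))
    (hU1 : ∀ m z, ‖((U m z : 𝔸ˣ) : 𝔸)‖ ≤ 1 ∧ ‖(((U m z)⁻¹ : 𝔸ˣ) : 𝔸)‖ ≤ 1)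
    -- (3.35) on the plaquettes through each bond, at that bond's block scale; stencil geometry at range `d₀`
    (h35 : ∀ μ x m n y, Through T μ x m n y → ‖(plaqU T U m n y : 𝔸) - 1‖ ≤ C₀ * ((g.L ^ g.scale (blk x))⁻¹) ^ 2)
    (hd₀B : ∀ μ x, g.dist (blk x) (blk ((T μ).symm x)) ≤ d₀) (hd₀F : ∀ μ x, g.dist (blk x) (blk (T μ x)) ≤ d₀)
    (hd₀FB : ∀ μ ν x, g.dist (blk x) (blk ((T ν).symm (T μ x))) ≤ d₀)
    (hd₀st : ∀ μ x (q : κ × S), q ∈ stBonds T μ x → g.dist (blk x) (blk q.2) ≤ d₀)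
    (hd₀loc : ∀ μ x (q : κ × S), q ∈ B9Eq375Locality.locBondsA' T μ x → g.dist (blk x) (blk q.2) ≤ d₀)
    (hd₀0 : ∀ y : g.Site, g.dist y y ≤ d₀)
    -- the `A`-independent data of the concrete `V′(A)` of (3.60): (3.19) kernels/multipliers and the `a`-weights of (3.24)
    (hw : ∀ y, 0 ≤ w y) (hcard : ∀ y, ((B9Eq360Vprime.block blk y).card : ℝ) * w y ≤ 1)
    (hkQ : ∀ y x, blk x = y → ‖kQ y x‖ ≤ w y) (hsQ : ∀ x, ‖sQ x‖ ≤ 1) (hcfun : ∀ y, |cfun y| ≤ a₀ * (g.len y ^ 2)⁻¹)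
    -- THEOREM 3.1 for `G′(U)`: (3.42)₁,₂,₃ at the rate `δ₀`
    {Gp : Module.End ℝ (S × ι → ℝ)}
    (h342_1 : HasMajorant (g := toB6 g Rr H) (fun p : S × ι => blk p.1) Gp
      (fun a a' => BG * g.len a ^ 2 * Real.exp (-(δ₀ * g.dist a a'))))
    (h342_2 : ∀ k : κ ⊕ κ, HasMajorant (g := toB6 g Rr H) (fun p : S × ι => blk p.1)
      (conj b (diffLetter T U ((g.eta : ℂ)⁻¹) k) * Gp) (fun a a' => BG * g.len a * Real.exp (-(δ₀ * g.dist a a'))))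
    (h342_3 : ∀ k : κ ⊕ κ, HasMajorant (g := toB6 g Rr H) (fun p : S × ι => blk p.1)
      (Gp * conj b (diffLetter T U ((g.eta : ℂ)⁻¹) k)) (fun a a' => BG * g.len a * Real.exp (-(δ₀ * g.dist a a'))))
    -- the (3.19) letters `Q′(U)`, `Q′*(U)` in their own typing with block-local two-space majorants, a section of the block map (FILE 17)
    (rep : g.Site → S × ι) (hrep : ∀ y : g.Site, blk (rep y).1 = y)
    {Qc : (S × ι → ℝ) →ₗ[ℝ] (g.Site → ℝ)} {Qcs : (g.Site → ℝ) →ₗ[ℝ] (S × ι → ℝ)} {Linv : Module.End ℝ (g.Site → ℝ)}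
    (hQc : HasMajorantHom (g := toB6 g Rr H) (fun p : S × ι => blk p.1) (fun y : g.Site => y) Qc
      (fun a a' : g.Site => κQ * (if a = a' then (1 : ℝ) else 0)))
    (hQcs : HasMajorantHom (g := toB6 g Rr H) (fun y : g.Site => y) (fun p : S × ι => blk p.1) Qcs
      (fun a a' : g.Site => κQ * (if a = a' then (1 : ℝ) else 0)))
    -- THEOREM 3.2 for `U`: (3.21) `C⁻¹ = (Q′G′²Q′*)⁻¹` exists (`hLinv`) with the KERNEL bound (3.48) at the rate `δ₀`
    (hLinv : (Qc ∘ₗ (Gp * Gp) ∘ₗ Qcs) * Linv = 1)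
    (h348 : ∀ y y' : g.Site, |B9Thm34Inv.ker (B9Thm34Inv.vol g d) Linv y y'| ≤
      B₁ * g.len y ^ (-(4 : ℝ)) * g.len y' ^ (-(d : ℝ)) * Real.exp (-(δ₀ * g.dist y y')))
    -- the (3.15) bond letters `Q(U)`, `Q*(U)` and the weight letter `a` of (3.24)/(3.26), with their majorants
    {G Qs Q a : Module.End ℝ ((κ × S) × ι → ℝ)}
    (hQb : HasMajorant (g := toB6 g Rr H) (fun q : (κ × S) × ι => blk q.1.2) Q (fun a a' => κQb * Real.exp (-(δ₀ * g.dist a a'))))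
    (hQsb : HasMajorant (g := toB6 g Rr H) (fun q : (κ × S) × ι => blk q.1.2) Qs (fun a a' => κQb * Real.exp (-(δ₀ * g.dist a a'))))
    (ha324 : HasMajorant (g := toB6 g Rr H) (fun q : (κ × S) × ι => blk q.1.2) a
      (fun a a' : g.Site => if a = a' then abar * (g.len a ^ 2)⁻¹ else 0))
    -- THEOREM 3.3 for `G(U)`: two-sided inverse of the concrete `Δ_a(U)` and its (3.42)-entries at the rate `δ₀`
    (hΔG : deltaA (conj b (lapDDLetter T ((g.eta : ℂ)⁻¹) U)) (conj b (dPrimeLetter T U g.eta))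
      (conjHom b (gradLin T ((g.eta : ℂ)⁻¹) U) ∘ₗ (1 - (Gp ∘ₗ Qcs ∘ₗ Linv ∘ₗ Qc ∘ₗ Gp)) ∘ₗ conjHom b (divLin T ((g.eta : ℂ)⁻¹) U)) Qs a Q * G = 1)
    (hGΔ : G * deltaA (conj b (lapDDLetter T ((g.eta : ℂ)⁻¹) U)) (conj b (dPrimeLetter T U g.eta))
      (conjHom b (gradLin T ((g.eta : ℂ)⁻¹) U) ∘ₗ (1 - (Gp ∘ₗ Qcs ∘ₗ Linv ∘ₗ Qc ∘ₗ Gp)) ∘ₗ conjHom b (divLin T ((g.eta : ℂ)⁻¹) U)) Qs a Q = 1)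
    (hG : HasMajorant (g := toB6 g Rr H) (fun q : (κ × S) × ι => blk q.1.2) G
      (fun a a' => B₀ * g.len a ^ 2 * Real.exp (-(δ₀ * g.dist a a'))))
    (hDG : ∀ k : κ ⊕ κ, HasMajorant (g := toB6 g Rr H) (fun q : (κ × S) × ι => blk q.1.2)
      (conj b (diffLetter (bT T) (bU U) ((g.eta : ℂ)⁻¹) k) * G) (fun a a' => B₀ * g.len a * Real.exp (-(δ₀ * g.dist a a'))))
    (hGD : ∀ k : κ ⊕ κ, HasMajorant (g := toB6 g Rr H) (fun q : (κ × S) × ι => blk q.1.2)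
      (G * conj b (diffLetter (bT T) (bU U) ((g.eta : ℂ)⁻¹) k)) (fun a a' => B₀ * g.len a * Real.exp (-(δ₀ * g.dist a a')))),
    ∀ (α₁ : ℝ), 0 ≤ α₁ → α₁ ≤ a₁ →
    -- the exponent field `A` in the domain (3.37), read blockwise in the shapes of FILES 1–19, and the `A`-dependent (3.59) data `kF`, `sF`
    ∀ (A : κ → S → 𝔸) (kF : g.Site → S → 𝔸 →L[ℝ] 𝔸) (sF : S → 𝔸 →L[ℝ] 𝔸),
      (∀ y x, blk x = y → ‖kF y x‖ ≤ Cq * α₁ * w y) → (∀ x, ‖sF x‖ ≤ Cq * α₁) →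
      (∀ ν k x, ‖((g.eta : ℂ)⁻¹) • covDstar T U ν (A k) x‖ ≤ α₁ * (g.len (blk x) ^ 2)⁻¹) →
      (∀ μ ν x, ‖((g.eta : ℂ)⁻¹) • covD T U μ (A ν) x‖ ≤ α₁ * (g.len (blk x) ^ 2)⁻¹) →
      (∀ μ ν x, ‖((g.eta : ℂ)⁻¹) • covDstar T U ν (A ν) (T μ x)‖ ≤ α₁ * (g.len (blk x) ^ 2)⁻¹) →
      (∀ μ x, ‖((g.eta : ℂ)⁻¹) • covDstar T U μ (tauB T U μ (A μ)) x‖ ≤ α₁ * (g.len (blk x) ^ 2)⁻¹) →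
      (∀ μ ν k x, ‖((g.eta : ℂ)⁻¹) • covD T U μ (A k) ((T ν).symm x)‖ ≤ α₁ * (g.len (blk x) ^ 2)⁻¹) →
      (∀ k x, ‖A k x‖ ≤ α₁ * (g.len (blk x))⁻¹) → (∀ ν k x, ‖tauB T U ν (A k) x‖ ≤ α₁ * (g.len (blk x))⁻¹) →
      (∀ μ k x, ‖tauF T U μ (A k) x‖ ≤ α₁ * (g.len (blk x))⁻¹) →
      (∀ k μ ν x, ‖A k ((T ν).symm (T μ x))‖ ≤ α₁ * (g.len (blk x))⁻¹) →
      (∀ μ x m z, (m, z) ∈ stBonds T μ x → ‖A m z‖ ≤ α₁ * (g.len (blk x))⁻¹) →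
      (∀ μ x m z, (m, z) ∈ B9Eq375Locality.locBondsA T μ x → ‖A m z‖ ≤ α₁ * (g.len (blk x))⁻¹) →
      (∀ μ x m n y, Through T μ x m n y →
        ‖covD T U m (A n) y‖ ≤ g.eta * (α₁ * ((g.len (blk x))⁻¹) ^ 2) ∧ ‖covD T U n (A m) y‖ ≤ g.eta * (α₁ * ((g.len (blk x))⁻¹) ^ 2)) →
    -- the (3.57)/(3.59) letters `F′₂(A)`, `F′₂*(A)` (block-local, size `c_F α₁`)
    ∀ {Qc' Fc : (S × ι → ℝ) →ₗ[ℝ] (g.Site → ℝ)} {Qcs' Fcs : (g.Site → ℝ) →ₗ[ℝ] (S × ι → ℝ)},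
      Qc' = Qc + Fc → Qcs' = Qcs + Fcs →
      HasMajorantHom (g := toB6 g Rr H) (fun p : S × ι => blk p.1) (fun y : g.Site => y) Fc
        (fun a a' : g.Site => cF * α₁ * (if a = a' then (1 : ℝ) else 0)) →
      HasMajorantHom (g := toB6 g Rr H) (fun y : g.Site => y) (fun p : S × ι => blk p.1) Fcs
        (fun a a' : g.Site => cF * α₁ * (if a = a' then (1 : ℝ) else 0)) →
    -- the (3.80)–(3.81) letters `F₂(A)`, `F₂*(A)` («|F₂(A)|, |F₂*(A)| ≦ O(1)α₁»), `P₂(A)` of (3.82)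
    ∀ {P₂ Qs' Q' F₂ F₂s : Module.End ℝ ((κ × S) × ι → ℝ)},
      Q' = Q + F₂ → Qs' = Qs + F₂s → P₂ = pTwo Qs Q F₂ F₂s a →
      HasMajorant (g := toB6 g Rr H) (fun q : (κ × S) × ι => blk q.1.2) F₂ (fun a a' => cFb * α₁ * Real.exp (-(δ₀ * g.dist a a'))) →
      HasMajorant (g := toB6 g Rr H) (fun q : (κ × S) × ι => blk q.1.2) F₂s (fun a a' => cFb * α₁ * Real.exp (-(δ₀ * g.dist a a'))) →
    ∃ (Tinv : Module.End ℝ (g.Site → ℝ)) (GExt : Module.End ℝ ((κ × S) × ι → ℝ)),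
      -- (ii) `C⁻¹(U′U)` = THE two-sided inverse of `Q′(U′U)G′²(U′U)Q′*(U′U)` (FILE 28, re-exported)
      Tinv * (Qc' ∘ₗ ((gPrimeExtEnd Gp (conj b (vPrimeConc T U g.eta A blk kQ kF sQ sF cfun) * Gp)) * (gPrimeExtEnd Gp (conj b (vPrimeConc T U g.eta A blk kQ kF sQ sF cfun) * Gp))) ∘ₗ Qcs') = 1 ∧
      (Qc' ∘ₗ ((gPrimeExtEnd Gp (conj b (vPrimeConc T U g.eta A blk kQ kF sQ sF cfun) * Gp)) * (gPrimeExtEnd Gp (conj b (vPrimeConc T U g.eta A blk kQ kF sQ sF cfun) * Gp))) ∘ₗ Qcs') * Tinv = 1 ∧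
      -- (iii) `G(U′U)` = THE two-sided inverse of the concrete `Δ_a(U′U)` built with this `C⁻¹(U′U)` (FILE 28, re-exported)
      deltaA (conj b (lapDDLetter T ((g.eta : ℂ)⁻¹) (prodCfg U g.eta A)))
          (conj b (dPrimeLetter T (prodCfg U g.eta A) g.eta))
          (conjHom b (gradLin T ((g.eta : ℂ)⁻¹) (prodCfg U g.eta A)) ∘ₗ (1 - ((Gp ∘ₗ Qcs ∘ₗ Linv ∘ₗ Qc ∘ₗ Gp) + (B9Eq360Vprime.pPrime Gp (gPrimeExtEnd Gp (conj b (vPrimeConc T U g.eta A blk kQ kF sQ sF cfun) * Gp)) (Qcs ∘ₗ secRes rep) (Qcs' ∘ₗ secRes rep) (secConj rep Linv) (secConj rep Tinv) (secExt rep ∘ₗ Qc) (secExt rep ∘ₗ Qc'))))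
            ∘ₗ conjHom b (divLin T ((g.eta : ℂ)⁻¹) (prodCfg U g.eta A))) Qs' a Q' * GExt = 1 ∧
      GExt *
      deltaA (conj b (lapDDLetter T ((g.eta : ℂ)⁻¹) (prodCfg U g.eta A)))
          (conj b (dPrimeLetter T (prodCfg U g.eta A) g.eta))
          (conjHom b (gradLin T ((g.eta : ℂ)⁻¹) (prodCfg U g.eta A)) ∘ₗ (1 - ((Gp ∘ₗ Qcs ∘ₗ Linv ∘ₗ Qc ∘ₗ Gp) + (B9Eq360Vprime.pPrime Gp (gPrimeExtEnd Gp (conj b (vPrimeConc T U g.eta A blk kQ kF sQ sF cfun) * Gp)) (Qcs ∘ₗ secRes rep) (Qcs' ∘ₗ secRes rep) (secConj rep Linv) (secConj rep Tinv) (secExt rep ∘ₗ Qc) (secExt rep ∘ₗ Qc'))))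
            ∘ₗ conjHom b (divLin T ((g.eta : ℂ)⁻¹) (prodCfg U g.eta A))) Qs' a Q' = 1 ∧
      -- (v) NEW: Theorem 3.3's (3.44)-type member (input Hölder norm, sup output) of THIS `G(U′U)`, for every pair of letters `D_l` (left, with
      -- the (3.42)₂-type entry `D_lG(U) ≺ B₀Lʲηe^{−δ₀d}`) and `D_s` (right, with the (3.42)₃-type entry `G(U)D_s ≺ B₀Lʲηe^{−δ₀d}`)
      (∀ (Dl Ds : Module.End ℝ ((κ × S) × ι → ℝ)),
        HasMajorant (g := toB6 g Rr H) (fun q : (κ × S) × ι => blk q.1.2) (Dl * G) (fun a a' => B₀ * g.len a * Real.exp (-(δ₀ * g.dist a a'))) →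
        HasMajorant (g := toB6 g Rr H) (fun q : (κ × S) × ι => blk q.1.2) (G * Ds) (fun a a' => B₀ * g.len a * Real.exp (-(δ₀ * g.dist a a'))) →
      ∀ (y' : g.Site) (μ : (κ × S) × ι → ℝ) (M : ℝ), BlockSupp (g := toB6 g Rr H) (fun q : (κ × S) × ι => blk q.1.2) μ y' M →
      ∀ (N : ℝ), 0 ≤ N →
        -- (3.44) FOR `U`, THIS INPUT: the mixed second differences of `G(U)λ` (in print `N = B′₀(ε)(‖λ‖_ε^{ξ′}(L^{j′}η)^ε + |λ|)`)
        (∀ (k : κ ⊕ κ) (z : (κ × S) × ι), |(((conj b (diffLetter (bT T) (bU U) ((g.eta : ℂ)⁻¹) k)) * G * Ds) μ) z| ≤ N * Real.exp (-(δ₀ * g.dist (blk z.1.2) y'))) →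
        (∀ z : (κ × S) × ι, |((Dl * G * Ds) μ) z| ≤ N * Real.exp (-(δ₀ * g.dist (blk z.1.2) y'))) →
        ∀ x : (κ × S) × ι, |((Dl * GExt * Ds) μ) x| ≤ B * (N + M) * Real.exp (-(δ₀ / 7 * g.dist (blk x.1.2) y'))) ∧
      -- (vi) NEW: Theorem 3.3's (3.45)-type member (input Hölder norm, Hölder output through a transported quotient functional `Φ`, FILE 34 §3)
      (∀ (Dl Ds : Module.End ℝ ((κ × S) × ι → ℝ)),
        HasMajorant (g := toB6 g Rr H) (fun q : (κ × S) × ι => blk q.1.2) (Dl * G) (fun a a' => B₀ * g.len a * Real.exp (-(δ₀ * g.dist a a'))) →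
        HasMajorant (g := toB6 g Rr H) (fun q : (κ × S) × ι => blk q.1.2) (G * Ds) (fun a a' => B₀ * g.len a * Real.exp (-(δ₀ * g.dist a a'))) →
      ∀ (Φ : (κ × S → 𝔸) →ₗ[ℝ] 𝔸) (y : g.Site) (p₀ : (κ × S) × ι), blk p₀.1.2 = y →
      ∀ (γ Bh cζ : ℝ), 0 ≤ Bh → 0 ≤ cζ →
        -- (3.43) with the derivative `D_l` on the left FOR `U`, this functional
        (∀ (y'' : g.Site) (ν : (κ × S) × ι → ℝ) (C : ℝ), BlockSupp (g := toB6 g Rr H) (fun q : (κ × S) × ι => blk q.1.2) ν y'' C →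
          ‖Φ ((coordEquiv b).symm (Dl (G ν)))‖ ≤ Bh * g.len y ^ (1 - γ) * cζ * Real.exp (-(δ₀ * g.dist y y'')) * C) →
      ∀ (y' : g.Site) (μ : (κ × S) × ι → ℝ) (M : ℝ), BlockSupp (g := toB6 g Rr H) (fun q : (κ × S) × ι => blk q.1.2) μ y' M →
      ∀ (N : ℝ), 0 ≤ N →
        (∀ (k : κ ⊕ κ) (z : (κ × S) × ι), |(((conj b (diffLetter (bT T) (bU U) ((g.eta : ℂ)⁻¹) k)) * G * Ds) μ) z| ≤ N * Real.exp (-(δ₀ * g.dist (blk z.1.2) y'))) →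
      -- (3.45) FOR `U`, THIS INPUT AND THIS FUNCTIONAL (in print `N₂ = B′₀(ε,β)(Lʲη)^{−β}(‖ζ‖_β^ξ + |ζ|)(…)`)
      ∀ (N₂ : ℝ), 0 ≤ N₂ → ‖Φ ((coordEquiv b).symm ((Dl * G * Ds) μ))‖ ≤ N₂ * Real.exp (-(δ₀ * g.dist y y')) →
        ‖Φ ((coordEquiv b).symm ((Dl * GExt * Ds) μ))‖ ≤
          B * (N₂ + Bh * g.len y ^ (1 - γ) * cζ * (g.len y)⁻¹ * (N + M)) * Real.exp (-(δ₀ / 7 * g.dist y y'))) := by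
  classical
  -- the scale-transfer constants of the chain, READ FROM THE GIVEN FUNCTION `Λf` (lattice-free)
  have hΛ : 1 ≤ Λf (1 / 100) := hΛf _ (by norm_num)
  -- the KERNEL-FREE uniform G-clause (R1: identities, left-entry operator clause), its Hölder re-run (the (3.43)-left member of `G(U′U)` per functional), the R1 twin of FILE 47 §2 ((3.77)) — BEFORE THE LATTICE
  obtain ⟨a₁, ha₁, B', hB', H28⟩ := thm34_G_clause_uniform b κ d δ₀ B₀ κQ BG B₁ cF Cq a₀ C₀ d₀ M₂ κQb cFb abar Λf hB₀ hκQ hBG hB₁ hcF hCq ha₀ hC₀ hM₂ hδ₀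
    hκQb hcFb habar hΛf hrepr
  obtain ⟨a₃, ha₃, B₃, hB₃, H36⟩ := thm34_G_holder_clause_uniform b κ d δ₀ B₀ κQ BG B₁ cF Cq a₀ C₀ d₀ M₂ κQb cFb abar Λf hB₀ hκQ hBG hB₁ hcF hCq ha₀ hC₀
    hM₂ hδ₀ hκQb hcFb habar hΛf hB₀' hrepr
  obtain ⟨a₂, ha₂, K, hK, H2⟩ := exists_threshold_pOne_uniform b κ d δ₀ κQ BG B₁ cF Cq a₀ d₀ M₂ Λf hκQ hBG hB₁ hcF hCq ha₀ hM₂ hδ₀ hΛf hrepr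
  -- the geometry of the cascade: exponents `1/100` at the printed rate `δ₀` (inner compositions and the outer one)
  have hΛ0 : 0 ≤ (Λf (1 / 100)) := zero_le_one.trans hΛ
  have hc₂ : 0 ≤ B6.c1 d δ₀ (1 / 100) := B6RandomWalk.c1_nonneg d δ₀ (1 / 100)
  have hδ5 : (0 : ℝ) ≤ 1 / 5 * δ₀ := by linarith only [hδ₀]
  have hρ0 : (0 : ℝ) ≤ 9 / 50 * δ₀ := by linarith only [hδ₀]
  have hr : 9 / 50 * δ₀ + (1 / 100 + 1 / 100) * δ₀ ≤ 1 / 5 * δ₀ := by linarith only [hδ₀]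
  have hrP : 1 / 5 * δ₀ + (1 / 100 + 1 / 100) * δ₀ ≤ δ₀ := by linarith only [hδ₀]
  have h15 : 1 / 5 * δ₀ ≤ δ₀ := by linarith only [hδ₀]
  have hρ₃ : (0 : ℝ) ≤ δ₀ / 7 := by linarith only [hδ₀]
  have hρ₃r : δ₀ / 7 + (1 / 100 + 1 / 100) * δ₀ ≤ δ₀ / 6 := by linarith only [hδ₀]
  have hρ₃ρ : δ₀ / 7 ≤ 9 / 50 * δ₀ := by linarith only [hδ₀]
  -- «of course with different constants» (p. 403): the two clause constants are continuous at `α₁ = 0`, hence bounded below a threshold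
  obtain ⟨KB₁, ε₁, hKB₁, hε₁, hF1⟩ := exists_bound_of_continuousAt
    (f := fun α₁ : ℝ => (1 + α₁ * B' * (Λf (1 / 100)) * (B6.c1 d δ₀ (1 / 100)) * (cV385 (Fintype.card κ) α₁ C₀ (M₂ * (∑ i, ‖b i‖) * Real.exp (1 / 5 * δ₀ * d₀))) * (B6.c1 d δ₀ (1 / 100))) + (α₁ * B' * (Λf (1 / 100)) * (B6.c1 d δ₀ (1 / 100)) * B₀ * (Λf (1 / 100)) * (B6.c1 d δ₀ (1 / 100)) * ((cV385 (Fintype.card κ) α₁ C₀ (M₂ * (∑ i, ‖b i‖) * Real.exp (1 / 5 * δ₀ * d₀))) + K + (kappa383 κQb cFb abar (Λf (1 / 100)) (B6.c1 d δ₀ (1 / 100)) α₁))))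
    (by
      unfold kappa383 cV385 B9Eq382V3Letters.cV0 B9Eq373V3.kΔ B9Eq373V3.kP
      fun_prop)
  obtain ⟨KB₂, ε₂, hKB₂, hε₂, hF2⟩ := exists_bound_of_continuousAt
    (f := fun α₁ : ℝ => 1 + (B₃ * (Λf (1 / 100)) * (B6.c1 d δ₀ (1 / 100)) * (α₁ * (B6.c1 d δ₀ (1 / 100)) * (((cV385 (Fintype.card κ) α₁ C₀ (M₂ * (∑ i, ‖b i‖) * Real.exp (1 / 5 * δ₀ * d₀))) + K + (kappa383 κQb cFb abar (Λf (1 / 100)) (B6.c1 d δ₀ (1 / 100)) α₁)) * B₀ * (Λf (1 / 100)) + (cV385 (Fintype.card κ) α₁ C₀ (M₂ * (∑ i, ‖b i‖) * Real.exp (1 / 5 * δ₀ * d₀)))))))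
    (by
      unfold kappa383 cV385 B9Eq382V3Letters.cV0 B9Eq373V3.kΔ B9Eq373V3.kP
      fun_prop)
  have hBtot : 0 ≤ KB₁ + KB₂ := add_nonneg hKB₁ hKB₂
  refine ⟨min (min (min a₁ a₂) (min a₃ (1 / 4))) (min (ε₁ / 2) (ε₂ / 2)),
    lt_min (lt_min (lt_min ha₁ ha₂) (lt_min ha₃ (by norm_num))) (lt_min (half_pos hε₁) (half_pos hε₂)), KB₁ + KB₂, hBtot, ?_⟩
  -- NOW the lattice, the background, the data, the Theorems-for-`U` inputs (block and kernel members); then `α₁`, `A` and the `A`-letters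
  intro S _ _ T U g _ _ _ Rr H blk kQ sQ cfun w hdnn htri hrefl hsym hlen hlenη hη hL h261 hST hT hU1 h35 hd₀B hd₀F hd₀FB hd₀st hd₀loc hd₀0 hw hcard
    hkQ hsQ hcfun Gp h342_1 h342_2 h342_3 rep hrep Qc Qcs Linv hQc hQcs hLinv h348 G Qs Q a hQb hQsb ha324 hΔG hGΔ hG hDG hGD
    α₁ hα₁0 hα₁1 A kF sF hkF hsF h337B h337F h337B' h337Bτ h337FB hA hAτB hAτF hAFB hAst hAloc hdAst Qc' Fc Qcs' Fcs h357
    h357s hFc hFcs P₂ Qs' Q' F₂ F₂s h380 h380s hP₂def hF₂ hF₂s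
  obtain ⟨y₀⟩ := ‹Nonempty g.Site›
  replace H28 := H28 T U blk kQ sQ cfun w hdnn htri hrefl hsym hlen hlenη hη hL h261 hST hT hU1 h35 hd₀B hd₀F hd₀FB hd₀st hd₀loc hd₀0 hw hcard hkQ
    hsQ hcfun h342_1 h342_2 h342_3 rep hrep hQc hQcs hLinv h348 hQb hQsb ha324 hΔG hGΔ hG hDG hGD
  replace H36 := H36 T U blk kQ sQ cfun w hdnn htri hrefl hsym hlen hlenη hη hL h261 hST hT hU1 h35 hd₀B hd₀F hd₀FB hd₀st hd₀loc hd₀0 hw hcard hkQ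
    hsQ hcfun h342_1 h342_2 h342_3 rep hrep hQc hQcs hLinv h348 hQb hQsb ha324 hΔG hGΔ hG hDG hGD
  replace H2 := H2 T U blk kQ sQ cfun w hdnn htri hrefl hsym hlen hlenη hη h261 hST hU1 hd₀B hd₀F hd₀0 hw hcard hkQ hsQ hcfun h342_1 h342_2 h342_3
    rep hrep hQc hQcs hLinv h348
  obtain ⟨hT1, -, hT1i, hT2i, -, -⟩ := hST (1 / 100) (by norm_num)
  have h261β : Ineq261 d (toB6 g Rr H) δ₀ (1 / 100) := h261 _ (by norm_num) (by norm_num)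
  have hm₁ : min (min (min a₁ a₂) (min a₃ (1 / 4))) (min (ε₁ / 2) (ε₂ / 2)) ≤ a₁ :=
    (min_le_left _ _).trans ((min_le_left _ _).trans (min_le_left _ _))
  have hm₂ : min (min (min a₁ a₂) (min a₃ (1 / 4))) (min (ε₁ / 2) (ε₂ / 2)) ≤ a₂ :=
    (min_le_left _ _).trans ((min_le_left _ _).trans (min_le_right _ _))
  have hm₃ : min (min (min a₁ a₂) (min a₃ (1 / 4))) (min (ε₁ / 2) (ε₂ / 2)) ≤ a₃ :=
    (min_le_left _ _).trans ((min_le_right _ _).trans (min_le_left _ _))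
  have hmq : min (min (min a₁ a₂) (min a₃ (1 / 4))) (min (ε₁ / 2) (ε₂ / 2)) ≤ 1 / 4 :=
    (min_le_left _ _).trans ((min_le_right _ _).trans (min_le_right _ _))
  have hmε₁ : min (min (min a₁ a₂) (min a₃ (1 / 4))) (min (ε₁ / 2) (ε₂ / 2)) ≤ ε₁ / 2 := (min_le_right _ _).trans (min_le_left _ _)
  have hmε₂ : min (min (min a₁ a₂) (min a₃ (1 / 4))) (min (ε₁ / 2) (ε₂ / 2)) ≤ ε₂ / 2 := (min_le_right _ _).trans (min_le_right _ _)
  have hα₁a : α₁ ≤ a₁ := hα₁1.trans hm₁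
  have hα₁b : α₁ ≤ a₂ := hα₁1.trans hm₂
  have hα₁c : α₁ ≤ a₃ := hα₁1.trans hm₃
  have hα₁q : α₁ ≤ 1 / 4 := hα₁1.trans hmq
  have habs : |α₁| = α₁ := abs_of_nonneg hα₁0
  have hα₁ε₁ : |α₁| < ε₁ := by rw [habs]; linarith only [hα₁1, hmε₁, hε₁]
  have hα₁ε₂ : |α₁| < ε₂ := by rw [habs]; linarith only [hα₁1, hmε₂, hε₂]
  -- the kernel-free clause at this `α₁`, `A`: `C⁻¹(U′U)`, `G(U′U)`, identities, the left-entry operator clause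
  obtain ⟨Tinv, GExt, e1, e2, e3, e4, hGL, -⟩ := H28 α₁ hα₁0 hα₁a A kF sF hkF
    hsF h337B h337F h337B' h337Bτ h337FB hA hAτB hAτF hAFB hAst hAloc hdAst h357 h357s hFc hFcs h380 h380s hP₂def hF₂ hF₂s
  -- its Hölder re-run at this `α₁`, `A`: ITS pair coincides with the clause's (uniqueness of two-sided inverses); keep its (3.43)-left clause for `G(U′U)`
  obtain ⟨Tinv₃, GExt₃, f1₃, -, -, g2₃, -, -, hGLp, -⟩ := H36 α₁ hα₁0 hα₁c A kF sF hkF hsF h337B h337F h337B' h337Bτ h337FB hA hAτB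
    hAτF hAFB hAst hAloc hdAst h357 h357s hFc hFcs h380 h380s hP₂def hF₂ hF₂s
  have hT₃ : Tinv₃ = Tinv := left_inv_eq_right_inv f1₃ e2
  subst Tinv₃
  have hG₃ : GExt₃ = GExt := left_inv_eq_right_inv g2₃ e3
  subst GExt₃
  -- (3.77) (R1 twin of FILE 47 §2) at this `α₁`, `A`: ITS `C⁻¹(U′U)` coincides with the clause's, so (3.77) holds for the clause's `P₁(A)`
  obtain ⟨Tinv₂, f1, -, hP₁⟩ := H2 α₁ hα₁0 hα₁b A kF sF hkF hsF h337B h337F h337Bτ hA hAτB h357 h357s hFc hFcs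
  have hTT : Tinv₂ = Tinv := left_inv_eq_right_inv f1 e2
  rw [hTT] at hP₁
  -- «η·α₁(Lʲη)⁻¹ ≦ 1/4», the constants of the concrete (3.73) letters at the rate `δ₀/5` (gen 11), (3.83) for `P₂(A)` at `δ₀/5`
  have hsmall : ∀ z : g.Site, g.eta * (α₁ * (g.len z)⁻¹) ≤ 1 / 4 := fun z => by
    have hq : g.eta * (g.len z)⁻¹ ≤ 1 := by
      rw [← div_eq_mul_inv]; exact (div_le_one (hlen z)).mpr (hlenη z)
    calc g.eta * (α₁ * (g.len z)⁻¹) = α₁ * (g.eta * (g.len z)⁻¹) := by ring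
      _ ≤ α₁ * 1 := mul_le_mul_of_nonneg_left hq hα₁0
      _ ≤ 1 / 4 := by linarith only [hα₁q]
  have hMc0 : 0 ≤ (M₂ * (∑ i, ‖b i‖) * Real.exp (1 / 5 * δ₀ * d₀)) := by positivity
  have hcV0 := cV0_nonneg (Fintype.card κ) hα₁0 hC₀
  have hcV : 0 ≤ (cV385 (Fintype.card κ) α₁ C₀ (M₂ * (∑ i, ‖b i‖) * Real.exp (1 / 5 * δ₀ * d₀))) := cV385_nonneg (Fintype.card κ) hα₁0 hC₀ hMc0
  have hκ₂ : 0 ≤ (kappa383 κQb cFb abar (Λf (1 / 100)) (B6.c1 d δ₀ (1 / 100)) α₁) := kappa383_nonneg hκQb hcFb habar hΛ0 hc₂ hα₁0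
  have hV₃ := conj_V₃Op_eq_gradForm T U b g.eta A
  have hV₃' := conj_V₃Op_eq_vThree T U b g.eta A
  have h371 := conj_lapDDLetter_prodCfg (b := b) (T := T) (U := U) hη.ne' A
  have hV0 := hasMajorant_V₃_zero (Rr := Rr) (H := H) b T U blk hη hL A C₀ d₀ (1 / 5 * δ₀) M₂ α₁ hα₁0 hC₀ hδ5 hM₂ hrepr hlen hsmall hU1
    h337B h337F h337B' hAst hAloc hdAst h35 hd₀B hd₀F hd₀FB hd₀st hd₀loc hd₀0
  have hV1 := hasMajorant_V₃_one (Rr := Rr) (H := H) b T U blk A d₀ (1 / 5 * δ₀) M₂ α₁ hα₁0 hδ5 hM₂ hrepr hlen hA hAτB hAτF hU1 hd₀B hd₀F hd₀0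
  have hV0' : HasMajorant (g := toB6 g Rr H) (fun q : (κ × S) × ι => blk q.1.2)
      (conj b (zeroLetter T U ((g.eta : ℂ)⁻¹) A + F₁Letter T U g.eta A)
        - conj b (dPrimeLetter T (prodCfg U g.eta A) g.eta - dPrimeLetter T U g.eta)
        + conj b (zeroLetter₂ T U ((g.eta : ℂ)⁻¹) A + F₂Letter T U g.eta A))
      (fun a a' => (cV385 (Fintype.card κ) α₁ C₀ (M₂ * (∑ i, ‖b i‖) * Real.exp (1 / 5 * δ₀ * d₀))) * α₁ * (g.len a ^ 2)⁻¹ * Real.exp (-(1 / 5 * δ₀ * g.dist a a'))) := by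
    refine hasMajorant_mono (g := toB6 g Rr H) _ hV0 fun z z' => ?_
    have h0' : 0 ≤ 28 * (Fintype.card κ : ℝ) * (Fintype.card κ + 1) * (M₂ * (∑ i, ‖b i‖) * Real.exp (1 / 5 * δ₀ * d₀)) * α₁ * (g.len z ^ 2)⁻¹ *
        Real.exp (-(1 / 5 * δ₀ * g.dist z z')) := by
      positivity
    have e : (cV385 (Fintype.card κ) α₁ C₀ (M₂ * (∑ i, ‖b i‖) * Real.exp (1 / 5 * δ₀ * d₀))) * α₁ * (g.len z ^ 2)⁻¹ * Real.exp (-(1 / 5 * δ₀ * g.dist z z'))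
        = cV0 (Fintype.card κ) α₁ C₀ * M₂ * (∑ i, ‖b i‖) * Real.exp (1 / 5 * δ₀ * d₀) * α₁ * (g.len z ^ 2)⁻¹ *
            Real.exp (-(1 / 5 * δ₀ * g.dist z z'))
          + 28 * (Fintype.card κ : ℝ) * (Fintype.card κ + 1) * (M₂ * (∑ i, ‖b i‖) * Real.exp (1 / 5 * δ₀ * d₀)) * α₁ * (g.len z ^ 2)⁻¹ *
            Real.exp (-(1 / 5 * δ₀ * g.dist z z')) := by
      unfold cV385; ring
    rw [e]
    linarith
  have hsum : ∑ _k ∈ (Finset.univ : Finset (κ ⊕ κ)), (14 * ((Fintype.card κ : ℝ) + 1) * M₂ * (∑ i, ‖b i‖) * Real.exp (1 / 5 * δ₀ * d₀)) ≤ (cV385 (Fintype.card κ) α₁ C₀ (M₂ * (∑ i, ‖b i‖) * Real.exp (1 / 5 * δ₀ * d₀))) := by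
    rw [Finset.sum_const, Finset.card_univ, Fintype.card_sum, nsmul_eq_mul, Nat.cast_add]
    have h0' : 0 ≤ cV0 (Fintype.card κ) α₁ C₀ * (M₂ * (∑ i, ‖b i‖) * Real.exp (1 / 5 * δ₀ * d₀)) := mul_nonneg hcV0 hMc0
    have e : (cV385 (Fintype.card κ) α₁ C₀ (M₂ * (∑ i, ‖b i‖) * Real.exp (1 / 5 * δ₀ * d₀))) = cV0 (Fintype.card κ) α₁ C₀ * (M₂ * (∑ i, ‖b i‖) * Real.exp (1 / 5 * δ₀ * d₀))
          + ((Fintype.card κ : ℝ) + Fintype.card κ) * (14 * ((Fintype.card κ : ℝ) + 1) * M₂ * (∑ i, ‖b i‖) * Real.exp (1 / 5 * δ₀ * d₀)) := by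
      unfold cV385; ring
    rw [e]
    linarith
  have hP₂ : HasMajorant (g := toB6 g Rr H) (fun q : (κ × S) × ι => blk q.1.2) P₂
      (fun a a' => (kappa383 κQb cFb abar (Λf (1 / 100)) (B6.c1 d δ₀ (1 / 100)) α₁) * α₁ * (g.len a ^ 2)⁻¹ * Real.exp (-(1 / 5 * δ₀ * g.dist a a'))) := by
    rw [hP₂def]
    exact ineq383_op (R := Rr) (H := H) (fun q : (κ × S) × ι => blk q.1.2) d δ₀ δ₀ (1 / 100) (1 / 100) (1 / 5 * δ₀) (Λf (1 / 100)) κQb cFb abar α₁ hκQb hcFb habar hα₁0 hΛ0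
      hδ5 (by norm_num) (by norm_num) hδ₀.le hrP hdnn htri h261β hT2i hQb hQsb hF₂ hF₂s ha324
  -- (3.84) for the concrete letters: `Δ_a(U′U) = Δ_a(U) − V(A)`, hence `G(U′U)(Δ_a(U) − V(A)) = 1` from the clause's identity
  have h384 : deltaA (conj b (lapDDLetter T ((g.eta : ℂ)⁻¹) (prodCfg U g.eta A)))
        (conj b (dPrimeLetter T (prodCfg U g.eta A) g.eta))
        (conjHom b (gradLin T ((g.eta : ℂ)⁻¹) (prodCfg U g.eta A)) ∘ₗ (1 - ((Gp ∘ₗ Qcs ∘ₗ Linv ∘ₗ Qc ∘ₗ Gp) + (B9Eq360Vprime.pPrime Gp (gPrimeExtEnd Gp (conj b (vPrimeConc T U g.eta A blk kQ kF sQ sF cfun) * Gp)) (Qcs ∘ₗ secRes rep) (Qcs' ∘ₗ secRes rep) (secConj rep Linv) (secConj rep Tinv) (secExt rep ∘ₗ Qc) (secExt rep ∘ₗ Qc'))))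
          ∘ₗ conjHom b (divLin T ((g.eta : ℂ)⁻¹) (prodCfg U g.eta A))) Qs' a Q' =
      deltaA (conj b (lapDDLetter T ((g.eta : ℂ)⁻¹) U)) (conj b (dPrimeLetter T U g.eta))
        (conjHom b (gradLin T ((g.eta : ℂ)⁻¹) U) ∘ₗ (1 - (Gp ∘ₗ Qcs ∘ₗ Linv ∘ₗ Qc ∘ₗ Gp)) ∘ₗ conjHom b (divLin T ((g.eta : ℂ)⁻¹) U)) Qs a Q -
        vTotal (conj b (V₃Op T U g.eta A))
          (((conjHom b (gradLin T ((g.eta : ℂ)⁻¹) (prodCfg U g.eta A)) - conjHom b (gradLin T ((g.eta : ℂ)⁻¹) U))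
              ∘ₗ (Gp ∘ₗ Qcs ∘ₗ Linv ∘ₗ Qc ∘ₗ Gp) ∘ₗ conjHom b (divLin T ((g.eta : ℂ)⁻¹) U)
            + conjHom b (gradLin T ((g.eta : ℂ)⁻¹) U) ∘ₗ (Gp ∘ₗ Qcs ∘ₗ Linv ∘ₗ Qc ∘ₗ Gp)
              ∘ₗ (conjHom b (divLin T ((g.eta : ℂ)⁻¹) (prodCfg U g.eta A)) - conjHom b (divLin T ((g.eta : ℂ)⁻¹) U))
            + (conjHom b (gradLin T ((g.eta : ℂ)⁻¹) (prodCfg U g.eta A)) - conjHom b (gradLin T ((g.eta : ℂ)⁻¹) U))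
              ∘ₗ (Gp ∘ₗ Qcs ∘ₗ Linv ∘ₗ Qc ∘ₗ Gp)
              ∘ₗ (conjHom b (divLin T ((g.eta : ℂ)⁻¹) (prodCfg U g.eta A)) - conjHom b (divLin T ((g.eta : ℂ)⁻¹) U))
            + conjHom b (gradLin T ((g.eta : ℂ)⁻¹) (prodCfg U g.eta A)) ∘ₗ (B9Eq360Vprime.pPrime Gp (gPrimeExtEnd Gp (conj b (vPrimeConc T U g.eta A blk kQ kF sQ sF cfun) * Gp)) (Qcs ∘ₗ secRes rep) (Qcs' ∘ₗ secRes rep) (secConj rep Linv) (secConj rep Tinv) (secExt rep ∘ₗ Qc) (secExt rep ∘ₗ Qc'))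
              ∘ₗ conjHom b (divLin T ((g.eta : ℂ)⁻¹) (prodCfg U g.eta A))))
          P₂ := by
    rw [eq384_sub (conj b (lapDDLetter T ((g.eta : ℂ)⁻¹) U)) (conj b (lapDDLetter T ((g.eta : ℂ)⁻¹) (prodCfg U g.eta A)))
      (conj b (dPrimeLetter T U g.eta)) (conj b (dPrimeLetter T (prodCfg U g.eta A) g.eta)) _ _ Qs Qs' Q Q' a
      (conj b (V₁Op T U g.eta A)) (conj b (V₂Op T U g.eta A)) _ F₂ F₂s h371
      (eq376_concrete T U b hη.ne' A (Gp ∘ₗ Qcs ∘ₗ Linv ∘ₗ Qc ∘ₗ Gp) (B9Eq360Vprime.pPrime Gp (gPrimeExtEnd Gp (conj b (vPrimeConc T U g.eta A blk kQ kF sQ sF cfun) * Gp)) (Qcs ∘ₗ secRes rep) (Qcs' ∘ₗ secRes rep) (secConj rep Linv) (secConj rep Tinv) (secExt rep ∘ₗ Qc) (secExt rep ∘ₗ Qc'))) h380 h380s, hV₃', hP₂def]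
  have hE := e4
  rw [h384] at hE
  -- common non-negativities and the clause constants at this `α₁`
  have hw1 : ∀ a : g.Site, 0 ≤ g.len a := fun a => (hlen a).le
  have hcK0 : ∀ k ∈ (Finset.univ : Finset (κ ⊕ κ)), (0 : ℝ) ≤ (14 * ((Fintype.card κ : ℝ) + 1) * M₂ * (∑ i, ‖b i‖) * Real.exp (1 / 5 * δ₀ * d₀)) := fun k _ => by positivity
  have hK1 := hF1 α₁ hα₁ε₁
  have hK2 := hF2 α₁ hα₁ε₂
  have hcoefN : 0 ≤ (1 + α₁ * B' * (Λf (1 / 100)) * (B6.c1 d δ₀ (1 / 100)) * (cV385 (Fintype.card κ) α₁ C₀ (M₂ * (∑ i, ‖b i‖) * Real.exp (1 / 5 * δ₀ * d₀))) * (B6.c1 d δ₀ (1 / 100))) := by positivity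
  have hcoefM : 0 ≤ (α₁ * B' * (Λf (1 / 100)) * (B6.c1 d δ₀ (1 / 100)) * B₀ * (Λf (1 / 100)) * (B6.c1 d δ₀ (1 / 100)) * ((cV385 (Fintype.card κ) α₁ C₀ (M₂ * (∑ i, ‖b i‖) * Real.exp (1 / 5 * δ₀ * d₀))) + K + (kappa383 κQb cFb abar (Λf (1 / 100)) (B6.c1 d δ₀ (1 / 100)) α₁))) := by positivity
  have hcoefVI : 0 ≤ (B₃ * (Λf (1 / 100)) * (B6.c1 d δ₀ (1 / 100)) * (α₁ * (B6.c1 d δ₀ (1 / 100)) * (((cV385 (Fintype.card κ) α₁ C₀ (M₂ * (∑ i, ‖b i‖) * Real.exp (1 / 5 * δ₀ * d₀))) + K + (kappa383 κQb cFb abar (Λf (1 / 100)) (B6.c1 d δ₀ (1 / 100)) α₁)) * B₀ * (Λf (1 / 100)) + (cV385 (Fintype.card κ) α₁ C₀ (M₂ * (∑ i, ‖b i‖) * Real.exp (1 / 5 * δ₀ * d₀)))))) := by positivity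
  refine ⟨Tinv, GExt, e1, e2, e3, e4, ?_, ?_⟩
  · -- (v) the (3.44)-type member
    intro Dl Ds hDlG hGDs y' μ M hμ N hN h344 h344l x
    have hM : 0 ≤ M := hμ.nonneg
    have hGDs5 := hasMajorant_rate_mono (R := Rr) (H := H) (fun q : (κ × S) × ι => blk q.1.2) B₀ (fun a => g.len a) hB₀ hw1 h15 hdnn hGDs
    have hDlE := hGL Dl (fun a => g.len a) hw1 hDlG
    have hdev := input344_of_inverse (R := Rr) (H := H) (fun q : (κ × S) × ι => blk q.1.2) d (Finset.univ : Finset (κ ⊕ κ))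
      δ₀ (1 / 5 * δ₀) (1 / 100) (1 / 100) (9 / 50 * δ₀) (Λf (1 / 100)) (cV385 (Fintype.card κ) α₁ C₀ (M₂ * (∑ i, ‖b i‖) * Real.exp (1 / 5 * δ₀ * d₀))) K (kappa383 κQb cFb abar (Λf (1 / 100)) (B6.c1 d δ₀ (1 / 100)) α₁) α₁ B₀ δ₀ (1 / 100) (1 / 100) (Λf (1 / 100)) (δ₀ / 6) (δ₀ / 7) B'
      (fun _ => (14 * ((Fintype.card κ : ℝ) + 1) * M₂ * (∑ i, ‖b i‖) * Real.exp (1 / 5 * δ₀ * d₀)))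
      hB₀ hcV hK hκ₂ hα₁0 hΛ0 hρ0 (by norm_num) (by norm_num) hδ₀.le hr hcK0 hsum hΛ0 hB' hρ₃ hρ₃r hρ₃ρ hdnn htri hlen h261β h261β hT1 hT1i
      (V1 := fun k => conj b (V1Letter T U A k) + conj b (V1Letter₂ T U A k))
      (D := fun k => conj b (diffLetter (bT T) (bU U) ((g.eta : ℂ)⁻¹) k))
      hV₃ hΔG hE hV0' (fun k _ => hV1 k) hP₁ hP₂ hGDs5 hDlE y' μ M hμ N hN
      (fun k _ z => (h344 k z).trans (mul_le_mul_of_nonneg_left (exp_rate_mono h15 (hdnn _ _)) hN))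
      (fun z => (h344l z).trans (mul_le_mul_of_nonneg_left (exp_rate_mono h15 (hdnn _ _)) hN)) x
    refine hdev.trans ?_
    have hE₀ : 0 ≤ Real.exp (-(δ₀ / 7 * g.dist (blk x.1.2) y')) := Real.exp_nonneg _
    have h1 : N * (1 + α₁ * B' * (Λf (1 / 100)) * (B6.c1 d δ₀ (1 / 100)) * (cV385 (Fintype.card κ) α₁ C₀ (M₂ * (∑ i, ‖b i‖) * Real.exp (1 / 5 * δ₀ * d₀))) * (B6.c1 d δ₀ (1 / 100))) ≤ N * ((1 + α₁ * B' * (Λf (1 / 100)) * (B6.c1 d δ₀ (1 / 100)) * (cV385 (Fintype.card κ) α₁ C₀ (M₂ * (∑ i, ‖b i‖) * Real.exp (1 / 5 * δ₀ * d₀))) * (B6.c1 d δ₀ (1 / 100))) + (α₁ * B' * (Λf (1 / 100)) * (B6.c1 d δ₀ (1 / 100)) * B₀ * (Λf (1 / 100)) * (B6.c1 d δ₀ (1 / 100)) * ((cV385 (Fintype.card κ) α₁ C₀ (M₂ * (∑ i, ‖b i‖) * Real.exp (1 / 5 * δ₀ * d₀))) + K + (kappa383 κQb cFb abar (Λf (1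 / 100)) (B6.c1 d δ₀ (1 / 100)) α₁)))) := mul_le_mul_of_nonneg_left (le_add_of_nonneg_right hcoefM) hN
    have h2 : M * (α₁ * B' * (Λf (1 / 100)) * (B6.c1 d δ₀ (1 / 100)) * B₀ * (Λf (1 / 100)) * (B6.c1 d δ₀ (1 / 100)) * ((cV385 (Fintype.card κ) α₁ C₀ (M₂ * (∑ i, ‖b i‖) * Real.exp (1 / 5 * δ₀ * d₀))) + K + (kappa383 κQb cFb abar (Λf (1 / 100)) (B6.c1 d δ₀ (1 / 100)) α₁))) ≤ M * ((1 + α₁ * B' * (Λf (1 / 100)) * (B6.c1 d δ₀ (1 / 100)) * (cV385 (Fintype.card κ) α₁ C₀ (M₂ * (∑ i, ‖b i‖) * Real.exp (1 / 5 * δ₀ * d₀))) * (B6.c1 d δ₀ (1 / 100))) + (α₁ * B' * (Λf (1 / 100)) * (B6.c1 d δ₀ (1 / 100)) * B₀ * (Λf (1 / 100)) * (B6.c1 d δ₀ (1 / 100)) * ((cV385 (Fintype.card κ) α₁ C₀ (M₂ * (∑ i, ‖b i‖) * Real.exp (1 / 5 * δ₀ * d₀))) + K + (kappa383 κQb cFb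 abar (Λf (1 / 100)) (B6.c1 d δ₀ (1 / 100)) α₁)))) := mul_le_mul_of_nonneg_left (le_add_of_nonneg_left hcoefN) hM
    have h3 : (N + M) * ((1 + α₁ * B' * (Λf (1 / 100)) * (B6.c1 d δ₀ (1 / 100)) * (cV385 (Fintype.card κ) α₁ C₀ (M₂ * (∑ i, ‖b i‖) * Real.exp (1 / 5 * δ₀ * d₀))) * (B6.c1 d δ₀ (1 / 100))) + (α₁ * B' * (Λf (1 / 100)) * (B6.c1 d δ₀ (1 / 100)) * B₀ * (Λf (1 / 100)) * (B6.c1 d δ₀ (1 / 100)) * ((cV385 (Fintype.card κ) α₁ C₀ (M₂ * (∑ i, ‖b i‖) * Real.exp (1 / 5 * δ₀ * d₀))) + K + (kappa383 κQb cFb abar (Λf (1 / 100)) (B6.c1 d δ₀ (1 / 100)) α₁)))) ≤ (N + M) * (KB₁ + KB₂) :=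
      mul_le_mul_of_nonneg_left (hK1.trans (le_add_of_nonneg_right hKB₂)) (add_nonneg hN hM)
    have h4 : N * (1 + α₁ * B' * (Λf (1 / 100)) * (B6.c1 d δ₀ (1 / 100)) * (cV385 (Fintype.card κ) α₁ C₀ (M₂ * (∑ i, ‖b i‖) * Real.exp (1 / 5 * δ₀ * d₀))) * (B6.c1 d δ₀ (1 / 100))) + M * (α₁ * B' * (Λf (1 / 100)) * (B6.c1 d δ₀ (1 / 100)) * B₀ * (Λf (1 / 100)) * (B6.c1 d δ₀ (1 / 100)) * ((cV385 (Fintype.card κ) α₁ C₀ (M₂ * (∑ i, ‖b i‖) * Real.exp (1 / 5 * δ₀ * d₀))) + K + (kappa383 κQb cFb abar (Λf (1 / 100)) (B6.c1 d δ₀ (1 / 100)) α₁))) ≤ (KB₁ + KB₂) * (N + M) := by linarith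
    exact mul_le_mul_of_nonneg_right h4 hE₀
  · -- (vi) the (3.45)-type member
    intro Dl Ds hDlG hGDs Φ y p₀ hp₀ γ Bh cζ hBh hcζ h343 y' μ M hμ N hN h344 N₂ hN₂ h345
    have hM : 0 ≤ M := hμ.nonneg
    have hGDs5 := hasMajorant_rate_mono (R := Rr) (H := H) (fun q : (κ × S) × ι => blk q.1.2) B₀ (fun a => g.len a) hB₀ hw1 h15 hdnn hGDs
    have hA₃ : 0 ≤ B₃ * Bh * g.len y ^ (1 - γ) * cζ := mul_nonneg (mul_nonneg (mul_nonneg hB₃ hBh) (Real.rpow_nonneg (hlen y).le _)) hcζ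
    -- the (3.43)-left member of `G(U′U)` for the functional `Φ ∘ coord⁻¹ ∘ D_l` (kernel-free re-run (iii))
    have hΨE : ∀ (y'' : g.Site) (ν : (κ × S) × ι → ℝ) (C : ℝ), BlockSupp (g := toB6 g Rr H) (fun q : (κ × S) × ι => blk q.1.2) ν y'' C →
        ‖(Φ ∘ₗ (coordEquiv (S := κ × S) b).symm.toLinearMap ∘ₗ Dl) (GExt ν)‖ ≤
          B₃ * Bh * g.len y ^ (1 - γ) * cζ * Real.exp (-(δ₀ / 6 * g.dist y y'')) * C := fun y'' ν C hν => by
      simpa only [LinearMap.coe_comp, Function.comp_apply, LinearEquiv.coe_toLinearMap] using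
        hGLp Dl Φ y p₀ hp₀ γ Bh cζ hBh hcζ h343 y'' ν C hν
    have hdev := input345_of_inverse (R := Rr) (H := H) (fun q : (κ × S) × ι => blk q.1.2) d (Finset.univ : Finset (κ ⊕ κ))
      δ₀ (1 / 5 * δ₀) (1 / 100) (1 / 100) (9 / 50 * δ₀) (Λf (1 / 100)) (cV385 (Fintype.card κ) α₁ C₀ (M₂ * (∑ i, ‖b i‖) * Real.exp (1 / 5 * δ₀ * d₀))) K (kappa383 κQb cFb abar (Λf (1 / 100)) (B6.c1 d δ₀ (1 / 100)) α₁) α₁ B₀ δ₀ (1 / 100) (1 / 100) (Λf (1 / 100)) (δ₀ / 6) (δ₀ / 7)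
      (B₃ * Bh * g.len y ^ (1 - γ) * cζ) (fun _ => (14 * ((Fintype.card κ : ℝ) + 1) * M₂ * (∑ i, ‖b i‖) * Real.exp (1 / 5 * δ₀ * d₀)))
      hB₀ hcV hK hκ₂ hα₁0 hΛ0 hρ0 (by norm_num) (by norm_num) hδ₀.le hr hcK0 hsum hΛ0 hA₃ hρ₃ hρ₃r hρ₃ρ hdnn htri hlen h261β h261β hT1 hT1i
      (V1 := fun k => conj b (V1Letter T U A k) + conj b (V1Letter₂ T U A k))
      (D := fun k => conj b (diffLetter (bT T) (bU U) ((g.eta : ℂ)⁻¹) k))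
      hV₃ hΔG hE hV0' (fun k _ => hV1 k) hP₁ hP₂ hGDs5 (Φ ∘ₗ (coordEquiv (S := κ × S) b).symm.toLinearMap ∘ₗ Dl) y hΨE y' μ M hμ N hN
      (fun k _ z => (h344 k z).trans (mul_le_mul_of_nonneg_left (exp_rate_mono h15 (hdnn _ _)) hN)) N₂ hN₂
      (by
        have h1 := h345.trans (mul_le_mul_of_nonneg_left (exp_rate_mono h15 (hdnn _ _)) hN₂)
        simpa only [LinearMap.coe_comp, Function.comp_apply, LinearEquiv.coe_toLinearMap, Module.End.mul_apply] using h1)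
    have hdev' : ‖Φ ((coordEquiv b).symm ((Dl * GExt * Ds) μ))‖ ≤
        (N₂ + B₃ * Bh * g.len y ^ (1 - γ) * cζ * (Λf (1 / 100)) * B6.c1 d δ₀ (1 / 100) * (g.len y)⁻¹ *
          (α₁ * B6.c1 d δ₀ (1 / 100) * (((cV385 (Fintype.card κ) α₁ C₀ (M₂ * (∑ i, ‖b i‖) * Real.exp (1 / 5 * δ₀ * d₀))) + K + (kappa383 κQb cFb abar (Λf (1 / 100)) (B6.c1 d δ₀ (1 / 100)) α₁)) * B₀ * (Λf (1 / 100)) * M + (cV385 (Fintype.card κ) α₁ C₀ (M₂ * (∑ i, ‖b i‖) * Real.exp (1 / 5 * δ₀ * d₀))) * N))) *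
        Real.exp (-(δ₀ / 7 * g.dist y y')) := by
      simpa only [LinearMap.coe_comp, Function.comp_apply, LinearEquiv.coe_toLinearMap, Module.End.mul_apply] using hdev
    refine hdev'.trans ?_
    have hE₀ : 0 ≤ Real.exp (-(δ₀ / 7 * g.dist y y')) := Real.exp_nonneg _
    have hS : 0 ≤ Bh * g.len y ^ (1 - γ) * cζ * (g.len y)⁻¹ * (N + M) :=
      mul_nonneg (mul_nonneg (mul_nonneg (mul_nonneg hBh (Real.rpow_nonneg (hlen y).le _)) hcζ) (inv_nonneg.mpr (hlen y).le))
        (add_nonneg hN hM)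
    have hQq : α₁ * B6.c1 d δ₀ (1 / 100) * (((cV385 (Fintype.card κ) α₁ C₀ (M₂ * (∑ i, ‖b i‖) * Real.exp (1 / 5 * δ₀ * d₀))) + K + (kappa383 κQb cFb abar (Λf (1 / 100)) (B6.c1 d δ₀ (1 / 100)) α₁)) * B₀ * (Λf (1 / 100)) * M + (cV385 (Fintype.card κ) α₁ C₀ (M₂ * (∑ i, ‖b i‖) * Real.exp (1 / 5 * δ₀ * d₀))) * N) ≤ (α₁ * (B6.c1 d δ₀ (1 / 100)) * (((cV385 (Fintype.card κ) α₁ C₀ (M₂ * (∑ i, ‖b i‖) * Real.exp (1 / 5 * δ₀ * d₀))) + K + (kappa383 κQb cFb abar (Λf (1 / 100)) (B6.c1 d δ₀ (1 / 100)) α₁)) * B₀ * (Λf (1 / 100)) + (cV385 (Fintype.card κ) α₁ C₀ (M₂ * (∑ i, ‖b i‖) * Real.exp (1 / 5 * δ₀ * d₀))))) * (N + M) := by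
      have i1 : ((cV385 (Fintype.card κ) α₁ C₀ (M₂ * (∑ i, ‖b i‖) * Real.exp (1 / 5 * δ₀ * d₀))) + K + (kappa383 κQb cFb abar (Λf (1 / 100)) (B6.c1 d δ₀ (1 / 100)) α₁)) * B₀ * (Λf (1 / 100)) * M ≤ ((cV385 (Fintype.card κ) α₁ C₀ (M₂ * (∑ i, ‖b i‖) * Real.exp (1 / 5 * δ₀ * d₀))) + K + (kappa383 κQb cFb abar (Λf (1 / 100)) (B6.c1 d δ₀ (1 / 100)) α₁)) * B₀ * (Λf (1 / 100)) * (N + M) :=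
        mul_le_mul_of_nonneg_left (le_add_of_nonneg_left hN) (by positivity)
      have i2 : (cV385 (Fintype.card κ) α₁ C₀ (M₂ * (∑ i, ‖b i‖) * Real.exp (1 / 5 * δ₀ * d₀))) * N ≤ (cV385 (Fintype.card κ) α₁ C₀ (M₂ * (∑ i, ‖b i‖) * Real.exp (1 / 5 * δ₀ * d₀))) * (N + M) := mul_le_mul_of_nonneg_left (le_add_of_nonneg_right hM) hcV
      have i3 := add_le_add i1 i2
      have e : (α₁ * (B6.c1 d δ₀ (1 / 100)) * (((cV385 (Fintype.card κ) α₁ C₀ (M₂ * (∑ i, ‖b i‖) * Real.exp (1 / 5 * δ₀ * d₀))) + K + (kappa383 κQb cFb abar (Λf (1 / 100)) (B6.c1 d δ₀ (1 / 100)) α₁)) * B₀ * (Λf (1 / 100)) + (cV385 (Fintype.card κ) α₁ C₀ (M₂ * (∑ i, ‖b i‖) * Real.exp (1 / 5 * δ₀ * d₀))))) * (N + M) = α₁ * B6.c1 d δ₀ (1 / 100) * (((cV385 (Fintype.card κ) α₁ C₀ (M₂ * (∑ i, ‖b i‖) * Real.exp (1 / 5 * δ₀ * d₀))) + K + (kappa383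 κQb cFb abar (Λf (1 / 100)) (B6.c1 d δ₀ (1 / 100)) α₁)) * B₀ * (Λf (1 / 100)) * (N + M) + (cV385 (Fintype.card κ) α₁ C₀ (M₂ * (∑ i, ‖b i‖) * Real.exp (1 / 5 * δ₀ * d₀))) * (N + M)) := by ring
      rw [e]
      exact mul_le_mul_of_nonneg_left i3 (mul_nonneg hα₁0 hc₂)
    have h1 : B₃ * Bh * g.len y ^ (1 - γ) * cζ * (Λf (1 / 100)) * B6.c1 d δ₀ (1 / 100) * (g.len y)⁻¹ *
          (α₁ * B6.c1 d δ₀ (1 / 100) * (((cV385 (Fintype.card κ) α₁ C₀ (M₂ * (∑ i, ‖b i‖) * Real.exp (1 / 5 * δ₀ * d₀))) + K + (kappa383 κQb cFb abar (Λf (1 / 100)) (B6.c1 d δ₀ (1 / 100)) α₁)) * B₀ * (Λf (1 / 100)) * M + (cV385 (Fintype.card κ) α₁ C₀ (M₂ * (∑ i, ‖b i‖) * Real.exp (1 / 5 * δ₀ * d₀))) * N))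
        ≤ (B₃ * (Λf (1 / 100)) * (B6.c1 d δ₀ (1 / 100)) * (α₁ * (B6.c1 d δ₀ (1 / 100)) * (((cV385 (Fintype.card κ) α₁ C₀ (M₂ * (∑ i, ‖b i‖) * Real.exp (1 / 5 * δ₀ * d₀))) + K + (kappa383 κQb cFb abar (Λf (1 / 100)) (B6.c1 d δ₀ (1 / 100)) α₁)) * B₀ * (Λf (1 / 100)) + (cV385 (Fintype.card κ) α₁ C₀ (M₂ * (∑ i, ‖b i‖) * Real.exp (1 / 5 * δ₀ * d₀)))))) * (Bh * g.len y ^ (1 - γ) * cζ * (g.len y)⁻¹ * (N + M)) := by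
      have hpre : 0 ≤ B₃ * Bh * g.len y ^ (1 - γ) * cζ * (Λf (1 / 100)) * B6.c1 d δ₀ (1 / 100) * (g.len y)⁻¹ :=
        mul_nonneg (mul_nonneg (mul_nonneg hA₃ hΛ0) hc₂) (inv_nonneg.mpr (hlen y).le)
      refine (mul_le_mul_of_nonneg_left hQq hpre).trans (le_of_eq ?_)
      ring
    have h2 : (B₃ * (Λf (1 / 100)) * (B6.c1 d δ₀ (1 / 100)) * (α₁ * (B6.c1 d δ₀ (1 / 100)) * (((cV385 (Fintype.card κ) α₁ C₀ (M₂ * (∑ i, ‖b i‖) * Real.exp (1 / 5 * δ₀ * d₀))) + K + (kappa383 κQb cFb abar (Λf (1 / 100)) (B6.c1 d δ₀ (1 / 100)) α₁)) * B₀ * (Λf (1 / 100)) + (cV385 (Fintype.card κ) α₁ C₀ (M₂ * (∑ i, ‖b i‖) * Real.exp (1 / 5 * δ₀ * d₀)))))) * (Bh * g.len y ^ (1 - γ) * cζ * (g.len y)⁻¹ * (N + M)) ≤ KB₂ * (Bh * g.len y ^ (1 - γ) * cζ * (g.len y)⁻¹ * (N + M)) :=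
      mul_le_mul_of_nonneg_right (by linarith only [hK2, hcoefVI]) hS
    have h3 : N₂ ≤ KB₂ * N₂ := by
      have : 0 ≤ (KB₂ - 1) * N₂ := mul_nonneg (by linarith only [hK2, hcoefVI]) hN₂
      linarith
    have h4 : 0 ≤ KB₁ * (N₂ + Bh * g.len y ^ (1 - γ) * cζ * (g.len y)⁻¹ * (N + M)) := mul_nonneg hKB₁ (add_nonneg hN₂ hS)
    have h5 : N₂ + B₃ * Bh * g.len y ^ (1 - γ) * cζ * (Λf (1 / 100)) * B6.c1 d δ₀ (1 / 100) * (g.len y)⁻¹ *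
          (α₁ * B6.c1 d δ₀ (1 / 100) * (((cV385 (Fintype.card κ) α₁ C₀ (M₂ * (∑ i, ‖b i‖) * Real.exp (1 / 5 * δ₀ * d₀))) + K + (kappa383 κQb cFb abar (Λf (1 / 100)) (B6.c1 d δ₀ (1 / 100)) α₁)) * B₀ * (Λf (1 / 100)) * M + (cV385 (Fintype.card κ) α₁ C₀ (M₂ * (∑ i, ‖b i‖) * Real.exp (1 / 5 * δ₀ * d₀))) * N))
        ≤ (KB₁ + KB₂) * (N₂ + Bh * g.len y ^ (1 - γ) * cζ * (g.len y)⁻¹ * (N + M)) := by nlinarith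
    exact mul_le_mul_of_nonneg_right h5 hE₀

end HolderInputU1

end Literature.MathematicalPhysics.QuantumFieldTheory.Balaban1983to89.B9Thm34HolderInputGClauseUniformR1

end
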